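import Summits.CriticalPhenomena.Ising3DConformalLimit.Theorems.ArmHyperscalingMergingFloorGlue
import Summits.CriticalPhenomena.Ising3DConformalLimit.Theorems.PerfectScreeningCoulombImpliesNontrivialGapOfBinder
import Summits.CriticalPhenomena.Ising3DConformalLimit.Theorems.LeeYangGapNearCriticalLeeYangGapSusceptibilityDoubling

/-!
# One-arm hyperscaling implies the near-critical Lee–Yang gap (crux 4945) — UNCONDITIONALLY
# (payer edge item stmt-CriticalPhenomena-15591 ⟹ item stmt-CriticalPhenomena-4945 as a tree theorem)

Route `LeeYangGap` (Ising3DConformalLimit), crux `NearCriticalLeeYangGap` (GAP, item stmt-CriticalPhenomena-4945: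
a block Lee–Yang zero at the CLT scale for infinitely many `L`; equivalently the critical block Binder cumulant
`g_L = (3Σ_L² − ⟨M_L⁴⟩)/Σ_L²` does not tend to `0` — block non-Gaussianity of critical `ℤ³` Ising along a
subsequence). Line `one_arm_saturation` (strategist s1, `Cruxes/NearCriticalLeeYangGap/Lines/one_arm_saturation.lean`)
reduces GAP to ONE-ARM HYPERSCALING (item stmt-CriticalPhenomena-15591, `ArmHyperscaling.OneArmHyperscaling`:
`∃ K ≥ 1, C₀, ∀ n ≥ 1, (⟨σ₀⟩⁺_{Λ_{Kn},β_c})² ≤ C₀⟨σ₀σ_{2ne₀}⟩_{β_c}`) modulo two elementary stubs, S2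
`stub_simultaneousScales` (field-term doubling (F) AND the axis ratio (B) `G_c(2⌊tL⌋e₀) ≤ R·G_c(2Le₀)` at
infinitely many common scales) and S3. This file makes the payer edge a THEOREM with NO stub:

  `nearCriticalLeeYangGap_of_oneArmHyperscaling : ArmHyperscaling.OneArmHyperscaling → LeeYangGap.NearCriticalLeeYangGap`.

The simplification over the skeleton: the axis ratio (B) is NOT needed. In the boundary term one compares
`a(Kn)² ≤ C₀G_c(2ne₀)` with `Σ_L` DIRECTLY through the sup-ball of radius `⌊2n/3⌋` around each point of
`Λ_{L/2}` (Messager–Miracle-Solé `G_c(2ne₀) ≤ G_c(z)` for `3‖z‖_∞ ≤ 2n`, landed `card_mul_axis_le_criticalBoxSum`,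
and `|Λ_{L/2}|χ(L/2) ≤ Σ_L`, landed `card_mul_boxSum_le_blockSum`): `|Λ_{L/2}|·n³·G_c(2ne₀) ≤ Σ_L` at EVERY
scale (`blockSum_ge_cube_mul_axis`), so `(V_L a(Kn))² ≤ (5832 C₀⁺/t³)·Σ_L` with `n = ⌊tL⌋`. What remains is the
field-term doubling (F) `χ(⌊ηL⌋) ≤ χ(L/2)/108` ALONE, and (F) holds for infinitely many `L` (with `η = 1/1000`)
by an elementary growth argument (`frequently_fieldDoubling`): if it failed for all large `L` then along
`L_k = 250^k L_0` one would get `χ(L_k/2) < 108^k χ(L_0/2)`, against the linear floor `χ_n ≥ c·n`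
(`criticalBoxSum_ge_linear`, from `c/‖x‖² ≤ G_c(x)`), since `250 > 108`.

Chain (all at `β = β_c(3)`, `h ≥ 0`, no scaling-limit hypothesis, no Coulomb hypothesis):
one-arm hyperscaling ⟹ (`matched_of_oneArm_at_goodScale`, per good scale: GHS tangent `mag_le_boxMag_add`, field
term via (F), boundary term via `blockSum_ge_cube_mul_axis`, `matched_arith`) matched upper critical isotherm
`(2L+1)³m(β_c, C/√Σ_L) ≤ ½β_cC√Σ_L` for infinitely many `L` (`matchedIsothermFrequently_of_oneArmHyperscaling`) ⟹
Binder floor `g_L ≥ 1/(2β_c²C²)` at those `L` (Lee–Yang deficit `stub_leeYangDeficit` + GKS block-field domination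
`stub_blockFieldDomination` + `binder_lower_of_saturation`, as in the skeleton's `frequently_binder_ge_of_matchedIsotherm`)
⟹ `g_L ↛ 0` ⟹ GAP (`stub_gapOfBinderNonvanishing`). So block non-Gaussianity of critical `ℤ³` Ising (clause (iii) in
Lee–Yang dress) follows from ONE one-point inequality, the saturation of Tasaki's hyperscaling inequality
`√G_c(x) ≤ ⟨σ₀⟩⁺_{|x|/3}` — open on `ℤ³`, numerically saturated (15591 MC j024350), false for `d ≥ 5`.

References: C. M. Newman, CMP 41 (1975) Thm 3 (Lee–Yang deficit); H. Tasaki, CMP 113 (1987) 49–65 (one-arm /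
hyperscaling inequalities); A. Messager, S. Miracle-Solé, JSP 17 (1977); B. Simon, CMP 77 (1980) (`G_c ≥ c‖x‖⁻²`).
-/

noncomputable section

namespace Summit.CriticalPhenomena.Ising3DConformalLimit.LeeYangGapNearCriticalLeeYangGap

open Literature.Probability.LatticeModels Filter Set Finset
open scoped Topology BigOperators
open Summit.CriticalPhenomena.Ising3DConformalLimit.PerfectScreeningCoulombImpliesNontrivial
open Summit.CriticalPhenomena.Ising3DConformalLimit.LeeYangGapGaussianLimitKillsBlockCoupling
open Summit.CriticalPhenomena.Ising3DConformalLimit.ArmHyperscalingMergingFloor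

/-! ### A. The linear floor on the critical box susceptibility -/

/-- **`χ_n(β_c) ≥ c·n` on `ℤ³`**: from the Simon–Lieb floor `c'‖x‖⁻² ≤ G_c(x)` at `x = 3n e₀`
(`criticalTwoPoint_bounds_holds`) and the Messager–Miracle-Solé count `|Λ_n| G_c(3ne₀) ≤ χ_n`
(`card_mul_axis_le_criticalBoxSum`): `χ_n ≥ (2n+1)³ c'/(9n²) ≥ (8c'/9)·n`. -/
theorem criticalBoxSum_ge_linear :
    ∃ c : ℝ, 0 < c ∧ ∀ n : ℕ, 1 ≤ n → c * n ≤ ∑ z ∈ box 3 n, criticalTwoPoint 3 z := by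
  obtain ⟨c, C, hc, hb⟩ := criticalTwoPoint_bounds_holds (d := 3) le_rfl
  refine ⟨8 * c / 9, by positivity, fun n hn => ?_⟩
  have hn0 : (0 : ℝ) < n := by exact_mod_cast hn
  -- the floor at `x = 3n e₀`: `c ≤ (3n)² G_c(3n e₀)`
  have hnorm : ‖(Pi.single 0 (((3 * n : ℕ)) : ℤ) : Site 3)‖ = ((3 * n : ℕ) : ℝ) := by
    rw [Pi.norm_single, Int.norm_natCast]
  have h3n0 : (0 : ℝ) < ((3 * n : ℕ) : ℝ) := by positivity
  have hx : (Pi.single 0 (((3 * n : ℕ)) : ℤ) : Site 3) ≠ 0 := by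
    rw [← norm_pos_iff, hnorm]; exact h3n0
  have hlo := (hb _ hx).1
  rw [hnorm, show (-(((3 : ℕ) : ℝ) - 1)) = -2 by norm_num, Real.rpow_neg h3n0.le, Real.rpow_two,
    ← div_eq_mul_inv, div_le_iff₀ (by positivity)] at hlo
  -- the count `(2n+1)³ G_c(3n e₀) ≤ χ_n`
  have hcount := card_mul_axis_le_criticalBoxSum (m := n) (s := 3 * n) (n := n) le_rfl le_rfl
  have hG0 : 0 ≤ criticalTwoPoint 3 (Pi.single 0 (((3 * n : ℕ)) : ℤ)) := criticalTwoPoint_nonneg' _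
  have hcube : 8 * (n : ℝ) ^ 3 ≤ (((2 * n + 1) ^ 3 : ℕ) : ℝ) := by
    push_cast; nlinarith [hn0]
  -- `(8c/9) n · 9n² = 8c n³ ≤ (3n)² G · 8 n ≤ ...`: assemble
  have h1 : 8 * (n : ℝ) ^ 3 * criticalTwoPoint 3 (Pi.single 0 (((3 * n : ℕ)) : ℤ)) ≤
      ∑ z ∈ box 3 n, criticalTwoPoint 3 z :=
    (mul_le_mul_of_nonneg_right hcube hG0).trans hcount
  have h2 : c ≤ (((3 * n : ℕ)) : ℝ) ^ 2 * criticalTwoPoint 3 (Pi.single 0 (((3 * n : ℕ)) : ℤ)) := by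
    linarith
  have h3 : (((3 * n : ℕ)) : ℝ) ^ 2 = 9 * (n : ℝ) ^ 2 := by push_cast; ring
  rw [h3] at h2
  -- `8c/9 · n ≤ 8 n³ G`: multiply `h2` by `8n/9`
  have h4 : 8 * c / 9 * (n : ℝ) ≤ 8 * (n : ℝ) ^ 3 * criticalTwoPoint 3 (Pi.single 0 (((3 * n : ℕ)) : ℤ)) := by
    have := mul_le_mul_of_nonneg_left h2 (show (0:ℝ) ≤ 8 * n / 9 by positivity)
    nlinarith [this]
  exact h4.trans h1

/-! ### B. Field-term doubling holds at infinitely many scales -/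

/-- **(F) frequently.** With `η = 1/1000`: `χ(⌊ηL⌋) ≤ χ(L/2)/108` for infinitely many `L`. Otherwise, for all
`L ≥ L₀`, `χ(L/2) < 108·χ(⌊L/1000⌋)`; along `L_k = 250^k·L_0` (`L_0 = 2L₀+2`), `⌊L_{k+1}/1000⌋ = L_k/4 ≤ L_k/2`,
so `χ(L_k/2) < 108^k χ(L_0/2)`, contradicting `χ(L_k/2) ≥ c·L_k/2 = c·250^k·(L₀+1)` for large `k` (`250 > 108`). -/
theorem frequently_fieldDoubling :
    ∃ᶠ L : ℕ in atTop,
      ∑ z ∈ box 3 ⌊(1 / 1000 : ℝ) * L⌋₊, criticalTwoPoint 3 z ≤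
        1 / 108 * ∑ z ∈ box 3 (L / 2), criticalTwoPoint 3 z := by
  obtain ⟨c, hc, hlin⟩ := criticalBoxSum_ge_linear
  by_contra hnot
  rw [Filter.not_frequently, Filter.eventually_atTop] at hnot
  obtain ⟨L₀, hL₀⟩ := hnot
  -- the geometric sequence `L_k = 250^k (2L₀+2)`
  set L0 : ℕ := 2 * L₀ + 2 with hL0
  have hfloor : ∀ k : ℕ, ⌊(1 / 1000 : ℝ) * ((250 ^ (k + 1) * L0 : ℕ) : ℝ)⌋₊ = 250 ^ k * L0 / 4 := by
    intro k
    have e : (1 / 1000 : ℝ) * ((250 ^ (k + 1) * L0 : ℕ) : ℝ) = ((250 ^ k * L0 : ℕ) : ℝ) / 4 := by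
      push_cast; ring
    rw [e, show (4 : ℝ) = ((4 : ℕ) : ℝ) by norm_num, Nat.floor_div_eq_div]
  -- one step: `χ(L_{k+1}/2) < 108 χ(L_k/2)`
  have hstep : ∀ k : ℕ, ∑ z ∈ box 3 (250 ^ (k + 1) * L0 / 2), criticalTwoPoint 3 z <
      108 * ∑ z ∈ box 3 (250 ^ k * L0 / 2), criticalTwoPoint 3 z := by
    intro k
    have hge : L₀ ≤ 250 ^ (k + 1) * L0 := by
      have : 1 ≤ 250 ^ (k + 1) := Nat.one_le_pow _ _ (by norm_num)
      nlinarith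
    have h := hL₀ _ hge
    rw [not_le, hfloor k] at h
    have hmono : ∑ z ∈ box 3 (250 ^ k * L0 / 4), criticalTwoPoint 3 z ≤
        ∑ z ∈ box 3 (250 ^ k * L0 / 2), criticalTwoPoint 3 z :=
      boxSum_mono (Nat.div_le_div_left (by norm_num) (by norm_num))
    linarith
  -- iterate: `χ(L_k/2) ≤ 108^k χ(L_0/2)`
  have hiter : ∀ k : ℕ, ∑ z ∈ box 3 (250 ^ k * L0 / 2), criticalTwoPoint 3 z ≤
      108 ^ k * ∑ z ∈ box 3 (L0 / 2), criticalTwoPoint 3 z := by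
    intro k
    induction k with
    | zero => simp
    | succ k ih =>
      calc ∑ z ∈ box 3 (250 ^ (k + 1) * L0 / 2), criticalTwoPoint 3 z
          ≤ 108 * ∑ z ∈ box 3 (250 ^ k * L0 / 2), criticalTwoPoint 3 z := (hstep k).le
        _ ≤ 108 * (108 ^ k * ∑ z ∈ box 3 (L0 / 2), criticalTwoPoint 3 z) :=
            mul_le_mul_of_nonneg_left ih (by norm_num)
        _ = 108 ^ (k + 1) * ∑ z ∈ box 3 (L0 / 2), criticalTwoPoint 3 z := by ring
  -- the linear floor at `L_k/2 = 250^k (L₀+1)`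
  have hhalf : ∀ k : ℕ, 250 ^ k * L0 / 2 = 250 ^ k * (L₀ + 1) := by
    intro k
    have e : 250 ^ k * L0 = 2 * (250 ^ k * (L₀ + 1)) := by rw [hL0]; ring
    rw [e, Nat.mul_div_cancel_left _ (by norm_num)]
  have hlow : ∀ k : ℕ, c * ((250 : ℝ) ^ k * ((L₀ : ℝ) + 1)) ≤
      ∑ z ∈ box 3 (250 ^ k * L0 / 2), criticalTwoPoint 3 z := by
    intro k
    rw [hhalf k]
    have h1 : 1 ≤ 250 ^ k * (L₀ + 1) := by
      have : 1 ≤ 250 ^ k := Nat.one_le_pow _ _ (by norm_num)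
      nlinarith
    have h := hlin _ h1
    push_cast at h
    exact h
  -- contradiction: `c (L₀+1) · 250^k ≤ 108^k · χ(L_0/2)` for all `k`
  set X : ℝ := ∑ z ∈ box 3 (L0 / 2), criticalTwoPoint 3 z with hX
  have hX0 : 0 ≤ X := boxSum_nonneg _
  have hcL : 0 < c * ((L₀ : ℝ) + 1) := by positivity
  -- `(250/108)^k ≤ X/(c(L₀+1))` for all `k`, impossible since `250/108 > 1`
  have hratio : ∀ k : ℕ, ((250 : ℝ) / 108) ^ k ≤ X / (c * ((L₀ : ℝ) + 1)) := by
    intro k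
    have h := (hlow k).trans (hiter k)
    rw [div_pow, div_le_div_iff₀ (by positivity) hcL]
    calc (250 : ℝ) ^ k * (c * ((L₀ : ℝ) + 1)) = c * ((250 : ℝ) ^ k * ((L₀ : ℝ) + 1)) := by ring
      _ ≤ (108 : ℝ) ^ k * X := h
      _ = X * 108 ^ k := by ring
  have htend : Tendsto (fun k : ℕ => ((250 : ℝ) / 108) ^ k) atTop atTop :=
    tendsto_pow_atTop_atTop_of_one_lt (by norm_num)
  obtain ⟨k, hk⟩ := (htend.eventually_gt_atTop (X / (c * ((L₀ : ℝ) + 1)))).exists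
  exact absurd (hratio k) (not_le.2 hk)

/-! ### C. The boundary-term comparison at every scale -/

/-- **`|Λ_{L/2}| · n³ · G_c(2n e₀) ≤ Σ_L`** for `n ≤ L/2` (every scale, no ratio hypothesis): each of the
`|Λ_{L/2}|` rows of `Σ_L` dominates `χ(L/2)` (`card_mul_boxSum_le_blockSum`), and `χ(L/2) ≥ (2m+1)³ G_c(2ne₀)` with
`m = ⌊2n/3⌋` (`card_mul_axis_le_criticalBoxSum`, Messager–Miracle-Solé), `2m+1 ≥ n`. -/
theorem blockSum_ge_cube_mul_axis {L n : ℕ} (hnL : n ≤ L / 2) :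
    (#(box 3 (L / 2)) : ℝ) * (n : ℝ) ^ 3 * criticalTwoPoint 3 (Pi.single 0 (2 * (n : ℤ))) ≤
      ∑ a ∈ box 3 L, ∑ b ∈ box 3 L, criticalCorr 3 2 ![a, b] := by
  have hm : 3 * (2 * n / 3) ≤ 2 * n := Nat.mul_div_le (2 * n) 3
  have hmn : 2 * n / 3 ≤ L / 2 := by omega
  have h1 := card_mul_axis_le_criticalBoxSum (m := 2 * n / 3) (s := 2 * n) (n := L / 2) hm hmn
  have h2 := card_mul_boxSum_le_blockSum (d := 3) L
  have hG0 : 0 ≤ criticalTwoPoint 3 (Pi.single 0 (2 * (n : ℤ))) := criticalTwoPoint_nonneg' _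
  have hcube : (n : ℝ) ^ 3 ≤ (((2 * (2 * n / 3) + 1) ^ 3 : ℕ) : ℝ) := by
    have h : n ≤ 2 * (2 * n / 3) + 1 := by omega
    exact_mod_cast Nat.pow_le_pow_left h 3
  have hcast : ((2 * n : ℕ) : ℤ) = 2 * (n : ℤ) := by push_cast; ring
  rw [hcast] at h1
  calc (#(box 3 (L / 2)) : ℝ) * (n : ℝ) ^ 3 * criticalTwoPoint 3 (Pi.single 0 (2 * (n : ℤ)))
      ≤ (#(box 3 (L / 2)) : ℝ) *
          ((((2 * (2 * n / 3) + 1) ^ 3 : ℕ) : ℝ) * criticalTwoPoint 3 (Pi.single 0 (2 * (n : ℤ)))) := by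
        rw [mul_assoc]
        exact mul_le_mul_of_nonneg_left (mul_le_mul_of_nonneg_right hcube hG0) (Nat.cast_nonneg _)
    _ ≤ (#(box 3 (L / 2)) : ℝ) * ∑ z ∈ box 3 (L / 2), criticalTwoPoint 3 z :=
        mul_le_mul_of_nonneg_left h1 (Nat.cast_nonneg _)
    _ ≤ _ := h2

/-! ### D. One-arm hyperscaling ⟹ the matched upper critical isotherm frequently -/

/-- **One-arm hyperscaling saturates the matched isotherm at every good scale.** If
`a(Kn)² ≤ C₀ G_c(2ne₀)` (`n ≥ 1`) then with `t = 1/(1000K)`, `A = 5832·max(C₀,0)/t³` and `C = 4(√A+1)/β_c`: at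
every `L ≥ ⌈2/t⌉` where the field-term doubling (F) `χ(⌊L/1000⌋) ≤ χ(L/2)/108` holds,
`(2L+1)³·m(β_c, C/√Σ_L) ≤ ½β_c C√Σ_L`. -/
theorem matchedIsothermFrequently_of_oneArmHyperscaling
    (hOAH : Summit.CriticalPhenomena.Ising3DConformalLimit.Theses.ArmHyperscaling.OneArmHyperscaling) :
    ∃ C : ℝ, 0 < C ∧ ∃ᶠ L : ℕ in atTop,
      (2 * (L : ℝ) + 1) ^ 3 * magnetizationInField 3 (criticalBeta 3)
          (C / Real.sqrt (plusExpect 3 (criticalBeta 3) 0 (fun σ => (∑ x ∈ box 3 L, spinAt x σ) ^ 2))) ≤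
        criticalBeta 3 * C / 2 *
          Real.sqrt (plusExpect 3 (criticalBeta 3) 0 (fun σ => (∑ x ∈ box 3 L, spinAt x σ) ^ 2)) := by
  obtain ⟨K, hK, C₀, hOA⟩ := hOAH
  have hβ : 0 < criticalBeta 3 := criticalBeta_pos_holds (d := 3) (by norm_num)
  have hKpos : (0 : ℝ) < K := by exact_mod_cast hK
  -- the ratio `t = η/K`, `η = 1/1000`
  obtain ⟨t, ht⟩ : ∃ t : ℝ, (1 / 1000 : ℝ) / K = t := ⟨_, rfl⟩
  have ht0 : 0 < t := ht ▸ div_pos (by norm_num) hKpos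
  have hηt : (K : ℝ) * t = 1 / 1000 := by rw [← ht]; field_simp
  have ht1 : t ≤ 1 / 1000 := by
    rw [← ht]; exact div_le_self (by norm_num) (by exact_mod_cast hK)
  -- constants
  have hC₁0 : 0 ≤ max C₀ 0 := le_max_right _ _
  obtain ⟨A, hA⟩ : ∃ A : ℝ, 5832 * max C₀ 0 / t ^ 3 = A := ⟨_, rfl⟩
  have hA0 : 0 ≤ A := hA ▸ by positivity
  refine ⟨4 * (Real.sqrt A + 1) / criticalBeta 3, by positivity, ?_⟩
  have hβC : criticalBeta 3 * (4 * (Real.sqrt A + 1) / criticalBeta 3) / 4 = Real.sqrt A + 1 := by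
    field_simp
  have hev : ∀ᶠ L : ℕ in atTop, ⌈2 / t⌉₊ ≤ L ∧ 1 ≤ L :=
    (eventually_ge_atTop ⌈2 / t⌉₊).and (eventually_ge_atTop 1)
  refine (frequently_fieldDoubling.and_eventually hev).mono ?_
  rintro L ⟨hdL, hLt, hL1⟩
  have hLr0 : (0 : ℝ) < L := by exact_mod_cast hL1
  -- the scales `n = ⌊tL⌋` with `tL/2 ≤ n ≤ tL`, `n ≥ 1`, `n ≤ L/2`, and `N = K n ≤ ⌊L/1000⌋`
  have htL2 : 2 ≤ t * L := by
    have h2 : 2 / t ≤ (L : ℝ) := (Nat.le_ceil _).trans (by exact_mod_cast hLt)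
    rw [mul_comm]; exact (div_le_iff₀ ht0).1 h2
  have hn1 : 1 ≤ ⌊t * L⌋₊ := Nat.succ_le_of_lt (Nat.floor_pos.2 (by linarith))
  have hnle : (⌊t * L⌋₊ : ℝ) ≤ t * L := Nat.floor_le (by positivity)
  have hnge : t * L / 2 ≤ (⌊t * L⌋₊ : ℝ) := by
    have h := Nat.lt_floor_add_one (t * L)
    linarith
  have hnL2 : ⌊t * L⌋₊ ≤ L / 2 := by
    have h1 : (⌊t * L⌋₊ : ℝ) ≤ (L : ℝ) / 1000 := hnle.trans (by nlinarith)
    have h2 : (⌊t * L⌋₊ : ℕ) * 1000 ≤ L := by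
      have : ((⌊t * L⌋₊ : ℕ) : ℝ) * 1000 ≤ (L : ℝ) := by linarith
      exact_mod_cast this
    omega
  have hNle : K * ⌊t * L⌋₊ ≤ ⌊(1 / 1000 : ℝ) * L⌋₊ := by
    refine Nat.le_floor ?_
    calc ((K * ⌊t * L⌋₊ : ℕ) : ℝ) = K * (⌊t * L⌋₊ : ℝ) := by push_cast; ring
      _ ≤ K * (t * L) := mul_le_mul_of_nonneg_left hnle hKpos.le
      _ = 1 / 1000 * L := by rw [← hηt]; ring
  -- the block variance `Σ_L > 0` and its two-point expansion
  have hSg : 0 < plusExpect 3 (criticalBeta 3) 0 (fun σ => (∑ x ∈ box 3 L, spinAt x σ) ^ 2) :=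
    sketchPub_blockVariance_pos L
  have hSg_eq := plusExpect_blockSpin_sq_eq_sum 3 L
  -- Step 1 at the matched field, in the box `Λ_{K n}`
  have hmag := mag_le_boxMag_add (N := K * ⌊t * L⌋₊) (h := 4 * (Real.sqrt A + 1) / criticalBeta 3 /
    Real.sqrt (plusExpect 3 (criticalBeta 3) 0 (fun σ => (∑ x ∈ box 3 L, spinAt x σ) ^ 2)))
    (by positivity)
  -- volumes: `V_L ≤ 27 |Λ_{L/2}|`, `L³ ≤ |Λ_{L/2}|`
  have hVH : (2 * (L : ℝ) + 1) ^ 3 ≤ 27 * (#(box 3 (L / 2)) : ℝ) := by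
    have h1 : (2 * (L : ℝ) + 1) ^ 3 = (#(box 3 L) : ℝ) := by
      rw [card_box]; push_cast; ring
    rw [h1]
    exact (card_box_le L hL1).trans
      (mul_le_mul_of_nonneg_left (pow_three_le_card_box_half L) (by norm_num))
  have hV0 : (0 : ℝ) ≤ (2 * (L : ℝ) + 1) ^ 3 := by positivity
  -- Step 2, field term: `V_L χ(N) ≤ Σ_L / 4`
  have hfield : (2 * (L : ℝ) + 1) ^ 3 * (∑ z ∈ box 3 (K * ⌊t * L⌋₊), criticalTwoPoint 3 z) ≤
      plusExpect 3 (criticalBeta 3) 0 (fun σ => (∑ x ∈ box 3 L, spinAt x σ) ^ 2) / 4 := by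
    have h1 : ∑ z ∈ box 3 (K * ⌊t * L⌋₊), criticalTwoPoint 3 z ≤
        1 / 108 * ∑ z ∈ box 3 (L / 2), criticalTwoPoint 3 z := (boxSum_mono hNle).trans hdL
    have h2 : (#(box 3 (L / 2)) : ℝ) * ∑ z ∈ box 3 (L / 2), criticalTwoPoint 3 z ≤
        plusExpect 3 (criticalBeta 3) 0 (fun σ => (∑ x ∈ box 3 L, spinAt x σ) ^ 2) := by
      rw [hSg_eq]; exact card_mul_boxSum_le_blockSum (d := 3) L
    have hχ0 : 0 ≤ ∑ z ∈ box 3 (L / 2), criticalTwoPoint 3 z := boxSum_nonneg _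
    calc (2 * (L : ℝ) + 1) ^ 3 * (∑ z ∈ box 3 (K * ⌊t * L⌋₊), criticalTwoPoint 3 z)
        ≤ (27 * (#(box 3 (L / 2)) : ℝ)) * (1 / 108 * ∑ z ∈ box 3 (L / 2), criticalTwoPoint 3 z) :=
          mul_le_mul hVH h1 (boxSum_nonneg _) (by positivity)
      _ = ((#(box 3 (L / 2)) : ℝ) * ∑ z ∈ box 3 (L / 2), criticalTwoPoint 3 z) / 4 := by ring
      _ ≤ _ := by linarith
  -- Step 3, boundary term: `(V_L a(N))² ≤ A Σ_L`, through `|Λ_{L/2}| n³ G_c(2ne₀) ≤ Σ_L`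
  have hbdry : ((2 * (L : ℝ) + 1) ^ 3 *
      isingExpect (zdGraph 3) (box 3 (K * ⌊t * L⌋₊)) (criticalBeta 3) 0 .plus (spinAt 0)) ^ 2 ≤
      A * plusExpect 3 (criticalBeta 3) 0 (fun σ => (∑ x ∈ box 3 L, spinAt x σ) ^ 2) := by
    have h1 : isingExpect (zdGraph 3) (box 3 (K * ⌊t * L⌋₊)) (criticalBeta 3) 0 .plus (spinAt 0) ^ 2 ≤
        max C₀ 0 * criticalTwoPoint 3 (Pi.single 0 (2 * ((⌊t * L⌋₊ : ℕ) : ℤ))) := by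
      have h := hOA _ hn1
      have ha_corr : isingCorr (zdGraph 3) (box 3 (K * ⌊t * L⌋₊)) (criticalBeta 3) 0 .plus {0} =
          isingExpect (zdGraph 3) (box 3 (K * ⌊t * L⌋₊)) (criticalBeta 3) 0 .plus (spinAt 0) := by
        simp [isingCorr]
      rw [ha_corr] at h
      exact h.trans (mul_le_mul_of_nonneg_right (le_max_left _ _) (criticalTwoPoint_nonneg' _))
    have h3 : (#(box 3 (L / 2)) : ℝ) * (⌊t * L⌋₊ : ℝ) ^ 3 *
        criticalTwoPoint 3 (Pi.single 0 (2 * ((⌊t * L⌋₊ : ℕ) : ℤ))) ≤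
        plusExpect 3 (criticalBeta 3) 0 (fun σ => (∑ x ∈ box 3 L, spinAt x σ) ^ 2) := by
      rw [hSg_eq]; exact blockSum_ge_cube_mul_axis hnL2
    have hG0 : 0 ≤ criticalTwoPoint 3 (Pi.single 0 (2 * ((⌊t * L⌋₊ : ℕ) : ℤ))) :=
      criticalTwoPoint_nonneg' _
    have ha0 := boxMag_nonneg (K * ⌊t * L⌋₊)
    have hcard : (L : ℝ) ^ 3 ≤ (#(box 3 (L / 2)) : ℝ) := pow_three_le_card_box_half L
    -- `(2L+1)^6 ≤ 729 L^6 ≤ 729 L³ |Λ_{L/2}|` and `L³ ≤ (8/t³) n³`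
    have hL3n : (L : ℝ) ^ 3 ≤ 8 / t ^ 3 * (⌊t * L⌋₊ : ℝ) ^ 3 := by
      have h1 : (L : ℝ) ≤ 2 / t * (⌊t * L⌋₊ : ℝ) := by
        rw [div_mul_eq_mul_div, le_div_iff₀ ht0]; linarith
      calc (L : ℝ) ^ 3 ≤ (2 / t * (⌊t * L⌋₊ : ℝ)) ^ 3 := pow_le_pow_left₀ hLr0.le h1 3
        _ = 8 / t ^ 3 * (⌊t * L⌋₊ : ℝ) ^ 3 := by ring
    have hV6 : ((2 * (L : ℝ) + 1) ^ 3) ^ 2 ≤ 729 * ((L : ℝ) ^ 3 * (L : ℝ) ^ 3) := by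
      have hL1r : (1 : ℝ) ≤ L := by exact_mod_cast hL1
      have : (2 * (L : ℝ) + 1) ^ 3 ≤ 27 * (L : ℝ) ^ 3 := by
        calc (2 * (L : ℝ) + 1) ^ 3 ≤ (3 * L) ^ 3 := pow_le_pow_left₀ (by positivity) (by linarith) 3
          _ = 27 * (L : ℝ) ^ 3 := by ring
      nlinarith [pow_nonneg hLr0.le 3]
    have hmain : ((2 * (L : ℝ) + 1) ^ 3) ^ 2 *
        criticalTwoPoint 3 (Pi.single 0 (2 * ((⌊t * L⌋₊ : ℕ) : ℤ))) ≤
        5832 / t ^ 3 * plusExpect 3 (criticalBeta 3) 0 (fun σ => (∑ x ∈ box 3 L, spinAt x σ) ^ 2) := by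
      calc ((2 * (L : ℝ) + 1) ^ 3) ^ 2 * criticalTwoPoint 3 (Pi.single 0 (2 * ((⌊t * L⌋₊ : ℕ) : ℤ)))
          ≤ 729 * ((L : ℝ) ^ 3 * (L : ℝ) ^ 3) *
              criticalTwoPoint 3 (Pi.single 0 (2 * ((⌊t * L⌋₊ : ℕ) : ℤ))) :=
            mul_le_mul_of_nonneg_right hV6 hG0
        _ ≤ 729 * ((#(box 3 (L / 2)) : ℝ) * (8 / t ^ 3 * (⌊t * L⌋₊ : ℝ) ^ 3)) *
              criticalTwoPoint 3 (Pi.single 0 (2 * ((⌊t * L⌋₊ : ℕ) : ℤ))) := by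
            refine mul_le_mul_of_nonneg_right (mul_le_mul_of_nonneg_left ?_ (by norm_num)) hG0
            exact mul_le_mul hcard hL3n (by positivity) (Nat.cast_nonneg _)
        _ = 5832 / t ^ 3 * ((#(box 3 (L / 2)) : ℝ) * (⌊t * L⌋₊ : ℝ) ^ 3 *
              criticalTwoPoint 3 (Pi.single 0 (2 * ((⌊t * L⌋₊ : ℕ) : ℤ)))) := by ring
        _ ≤ 5832 / t ^ 3 * plusExpect 3 (criticalBeta 3) 0 (fun σ => (∑ x ∈ box 3 L, spinAt x σ) ^ 2) :=
            mul_le_mul_of_nonneg_left h3 (by positivity)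
    calc ((2 * (L : ℝ) + 1) ^ 3 *
          isingExpect (zdGraph 3) (box 3 (K * ⌊t * L⌋₊)) (criticalBeta 3) 0 .plus (spinAt 0)) ^ 2
        = ((2 * (L : ℝ) + 1) ^ 3) ^ 2 *
          isingExpect (zdGraph 3) (box 3 (K * ⌊t * L⌋₊)) (criticalBeta 3) 0 .plus (spinAt 0) ^ 2 := by
          ring
      _ ≤ ((2 * (L : ℝ) + 1) ^ 3) ^ 2 *
          (max C₀ 0 * criticalTwoPoint 3 (Pi.single 0 (2 * ((⌊t * L⌋₊ : ℕ) : ℤ)))) :=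
          mul_le_mul_of_nonneg_left h1 (by positivity)
      _ = max C₀ 0 * (((2 * (L : ℝ) + 1) ^ 3) ^ 2 *
          criticalTwoPoint 3 (Pi.single 0 (2 * ((⌊t * L⌋₊ : ℕ) : ℤ)))) := by ring
      _ ≤ max C₀ 0 * (5832 / t ^ 3 *
          plusExpect 3 (criticalBeta 3) 0 (fun σ => (∑ x ∈ box 3 L, spinAt x σ) ^ 2)) :=
          mul_le_mul_of_nonneg_left hmain hC₁0
      _ = A * plusExpect 3 (criticalBeta 3) 0 (fun σ => (∑ x ∈ box 3 L, spinAt x σ) ^ 2) := by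
          rw [← hA]; ring
  -- Step 4: assembly
  exact matched_arith hβ (by positivity) hSg hV0 hA0 hβC hmag hfield hbdry

/-! ### E. Matched isotherm frequently ⟹ Binder floor frequently ⟹ GAP -/

/-- **Matched saturation forces a Binder floor, scale by scale, under `∃ᶠ`** (Lee–Yang deficit
`stub_leeYangDeficit` + GKS block-field domination `stub_blockFieldDomination` + `binder_lower_of_saturation`;
the skeleton's `frequently_binder_ge_of_matchedIsotherm` with `Matched` unfolded). [cite: Newman1975, Thm 3] -/
theorem frequently_binder_ge_of_matched {C : ℝ} (hC : 0 < C)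
    (hfr : ∃ᶠ L : ℕ in atTop,
      (2 * (L : ℝ) + 1) ^ 3 * magnetizationInField 3 (criticalBeta 3)
          (C / Real.sqrt (plusExpect 3 (criticalBeta 3) 0 (fun σ => (∑ x ∈ box 3 L, spinAt x σ) ^ 2))) ≤
        criticalBeta 3 * C / 2 *
          Real.sqrt (plusExpect 3 (criticalBeta 3) 0 (fun σ => (∑ x ∈ box 3 L, spinAt x σ) ^ 2))) :
    ∃ᶠ L : ℕ in atTop,
      1 / (2 * criticalBeta 3 ^ 2 * C ^ 2) ≤
        (3 * (plusExpect 3 (criticalBeta 3) 0 (fun σ => (∑ x ∈ box 3 L, spinAt x σ) ^ 2)) ^ 2 -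
              plusExpect 3 (criticalBeta 3) 0 (fun σ => (∑ x ∈ box 3 L, spinAt x σ) ^ 4)) /
            (plusExpect 3 (criticalBeta 3) 0 (fun σ => (∑ x ∈ box 3 L, spinAt x σ) ^ 2)) ^ 2 := by
  have hβ : 0 < criticalBeta 3 := criticalBeta_pos_holds (d := 3) (by norm_num)
  refine hfr.mono fun L hL => ?_
  set Sg : ℝ := plusExpect 3 (criticalBeta 3) 0 (fun σ => (∑ x ∈ box 3 L, spinAt x σ) ^ 2) with hSgdef
  have hSg : 0 < Sg := sketchPub_blockVariance_pos L
  set h : ℝ := C / Real.sqrt Sg with hh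
  have hh0 : 0 ≤ h := by positivity
  have hdom := stub_blockFieldDomination L h hh0
  obtain ⟨hZ, hdefL⟩ := stub_leeYangDeficit L (criticalBeta 3 * h) (by positivity)
  have hL' : (2 * (L : ℝ) + 1) ^ 3 * magnetizationInField 3 (criticalBeta 3) h ≤
      criticalBeta 3 * C / 2 * Real.sqrt Sg := by
    simpa [hh, hSgdef] using hL
  have key := binder_lower_of_saturation (β := criticalBeta 3) (C := C) (Sg := Sg)
    (K := 3 * Sg ^ 2 - plusExpect 3 (criticalBeta 3) 0 (fun σ => (∑ x ∈ box 3 L, spinAt x σ) ^ 4))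
    hβ hC hSg hZ (by simpa [hh, mul_assoc] using hdefL) hdom (by simpa [hh] using hL')
  simpa [hSgdef] using key

/-- **ONE-ARM HYPERSCALING ⟹ THE NEAR-CRITICAL LEE–YANG GAP, unconditionally** (payer edge item
stmt-CriticalPhenomena-15591 ⟹ item stmt-CriticalPhenomena-4945 as a tree theorem; line `one_arm_saturation` with
its stubs S2/S3 bypassed: the axis-ratio condition is unnecessary, the field doubling holds frequently).
`(⟨σ₀⟩⁺_{Λ_{Kn},β_c})² ≤ C₀⟨σ₀σ_{2ne₀}⟩_{β_c}` (`n ≥ 1`) ⟹ matched isotherm frequently ⟹ Binder floor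
`g_L ≥ 1/(2β_c²C²)` frequently ⟹ `g_L ↛ 0` ⟹ `NearCriticalLeeYangGap` (`stub_gapOfBinderNonvanishing`). -/
theorem nearCriticalLeeYangGap_of_oneArmHyperscaling
    (hOAH : Summit.CriticalPhenomena.Ising3DConformalLimit.Theses.ArmHyperscaling.OneArmHyperscaling) :
    Summit.CriticalPhenomena.Ising3DConformalLimit.Theses.LeeYangGap.NearCriticalLeeYangGap := by
  obtain ⟨C, hC, hfr⟩ := matchedIsothermFrequently_of_oneArmHyperscaling hOAH
  refine stub_gapOfBinderNonvanishing ?_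
  intro hT
  have hε : (0 : ℝ) < 1 / (2 * criticalBeta 3 ^ 2 * C ^ 2) := by
    have hβ : 0 < criticalBeta 3 := criticalBeta_pos_holds (d := 3) (by norm_num)
    positivity
  have hev := hT.eventually (gt_mem_nhds hε)
  obtain ⟨L, hge, hlt⟩ := ((frequently_binder_ge_of_matched hC hfr).and_eventually hev).exists
  exact absurd hlt (not_lt.2 hge)

end Summit.CriticalPhenomena.Ising3DConformalLimit.LeeYangGapNearCriticalLeeYangGap

end
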